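import Mathlib.Algebra.BigOperators.Ring.Finset
import Mathlib.Data.Fintype.BigOperators
import Literature.Computability.AlgebraicComplexity.WeightedEntropyMax
import HarnessLib

/-!
# Types of words: counting, type classes and the Gibbs bound (method of types)

Topic: `Literature/Computability/AlgebraicComplexity`; support file for the proof of CVZ Thm. 3.34
(`ChristandlVranaZuiddam2023_le_upperSupportFunctional`, `QuantumFunctionals.lean`: the quantum
functional of a complex 3-tensor is at most its Strassen upper support functional). Both the printed
proof (decomposition of `t^{⊗N}` into type classes, [CVZ23, proof of Thm. 3.34, p. 17]) and the
elementary proof given in this tree run on the *method of types* for words `u : Fin n → ι` over a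
finite alphabet `ι` (Csiszár–Körner): the *type* of `u` is its vector of letter counts.

## Content (all elementary; the definitions are the two obvious ones)

* `letterCount u : ι → ℕ` — the type of `u`, i.e. its letter counts `#{m | u m = i}`; `∑ᵢ letterCount u i = n`; invariance under
  permutations of positions and the converse `exists_perm_of_letterCount_eq` (two words of the same type
  differ by a permutation of positions); `prod_apply_eq_prod_pow_letterCount` (`∏ₘ f(uₘ) = ∏ᵢ f(i)^{kᵢ}`).
* Counting: `card_image_letterCount_le` — at most `(n+1)^|ι|` types; `card_filter_letterCount_le` — a bound on
  every type class gives a bound on the number of words whose type satisfies a predicate.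
* `typeWeight n k = ∏ᵢ (kᵢ/n)^{kᵢ}` (`= 2^{-n H(k/n)}`, `typeWeight_eq_exp`): the probability of one word of
  type `k` under the i.i.d. law of its own empirical distribution. `card_letterCount_class_mul_typeWeight_le`:
  the type class of `k` has at most `typeWeight n k⁻¹ = 2^{n H(k/n)}` elements (multinomial theorem);
  `prod_pow_letterCount_le_typeWeight`: under ANY sub-probability vector `r` a word of type `k` has
  probability `∏ᵢ rᵢ^{kᵢ} ≤ typeWeight n k` (Gibbs' inequality in product form).

Entropies are in bits (`shannonEntropy` of `QuantumFunctionals.lean`). References: I. Csiszár,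
J. Körner, *Information Theory: Coding Theorems for Discrete Memoryless Systems* (2nd ed. 2011), Ch. 2
(method of types) — cited as folklore; M. Christandl, P. Vrana, J. Zuiddam, *Universal points in the
asymptotic spectrum of tensors*, J. Amer. Math. Soc. 36 (2023), proof of Thm. 3.34.
-/

noncomputable section

open scoped BigOperators
open Real (negMulLog)

namespace Literature.Computability.AlgebraicComplexity

/-! ## The type of a word -/

section WordType

variable {ι : Type*} [DecidableEq ι] {n : ℕ}

/-- The **type** (vector of letter counts, empirical distribution times `n`) of a word
`u : Fin n → ι`: `letterCount u i = #{m | u m = i}`. [folklore] -/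
def letterCount (u : Fin n → ι) : ι → ℕ := fun i => (Finset.univ.filter fun m => u m = i).card

/-- Unfolding of `letterCount`. [folklore] -/
theorem letterCount_apply (u : Fin n → ι) (i : ι) :
    letterCount u i = (Finset.univ.filter fun m => u m = i).card := rfl

/-- The count of a letter, as a real number, is a sum of indicators over positions. [folklore] -/
theorem letterCount_eq_sum_ite (u : Fin n → ι) (i : ι) :
    (letterCount u i : ℝ) = ∑ m, if u m = i then (1 : ℝ) else 0 := by
  rw [letterCount_apply]
  exact Finset.natCast_card_filter _ _

/-- Each letter occurs at most `n` times. [folklore] -/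
theorem letterCount_le (u : Fin n → ι) (i : ι) : letterCount u i ≤ n :=
  (Finset.card_filter_le _ _).trans (by simp)

/-- The counts of a word of length `n` sum to `n`. [folklore] -/
theorem sum_letterCount [Fintype ι] (u : Fin n → ι) : ∑ i, letterCount u i = n := by
  have h := Finset.card_eq_sum_card_fiberwise (f := u) (s := Finset.univ) (t := Finset.univ)
    fun _ _ => Finset.mem_coe.2 (Finset.mem_univ _)
  simp only [Finset.card_univ, Fintype.card_fin] at h
  simpa [letterCount] using h.symm

/-- In particular a nonempty word has a letter with a positive count. [folklore] -/
theorem letterCount_pos_of_apply (u : Fin n → ι) (m : Fin n) : 0 < letterCount u (u m) :=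
  Finset.card_pos.2 ⟨m, by simp⟩

/-- The type is invariant under permutations of the positions. [folklore] -/
theorem letterCount_comp_perm (u : Fin n → ι) (σ : Equiv.Perm (Fin n)) :
    letterCount (u ∘ σ) = letterCount u := by
  funext i
  simp only [letterCount, Function.comp_apply]
  exact Finset.card_equiv σ fun m => by simp

/-- **Words of the same type differ by a permutation of positions** (glue bijections between the
letter fibres). [folklore] -/
theorem exists_perm_of_letterCount_eq {u v : Fin n → ι} (h : letterCount u = letterCount v) :
    ∃ σ : Equiv.Perm (Fin n), ∀ m, v (σ m) = u m := by
  classical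
  have hcard : ∀ a : ι, Fintype.card {m // u m = a} = Fintype.card {m // v m = a} := by
    intro a
    rw [Fintype.card_subtype, Fintype.card_subtype]
    exact congrFun h a
  exact ⟨Equiv.ofFiberEquiv fun a => Fintype.equivOfCardEq (hcard a),
    fun m => Equiv.ofFiberEquiv_map (fun a => Fintype.equivOfCardEq (hcard a)) m⟩

/-- Regrouping a product over positions by letters: `∏ₘ f (u m) = ∏ᵢ f i ^ (letterCount u i)`.
[folklore] -/
theorem prod_apply_eq_prod_pow_letterCount [Fintype ι] {M : Type*} [CommMonoid M] (f : ι → M)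
    (u : Fin n → ι) : ∏ m, f (u m) = ∏ i, f i ^ letterCount u i := by
  rw [Finset.prod_comp]
  refine Finset.prod_subset (Finset.subset_univ _) fun i _ hi => ?_
  have h0 : (Finset.univ.filter fun m => u m = i) = ∅ := by
    refine Finset.filter_eq_empty_iff.2 fun m _ hm => hi ?_
    exact Finset.mem_image.2 ⟨m, Finset.mem_univ _, hm⟩
  change f i ^ letterCount u i = 1
  rw [letterCount_apply, h0, Finset.card_empty, pow_zero]

/-- **There are at most `(n+1)^|ι|` types of words of length `n`** (a type is a function
`ι → {0, …, n}`). [folklore] -/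
theorem card_image_letterCount_le [Fintype ι] :
    (Finset.univ.image (letterCount : (Fin n → ι) → ι → ℕ)).card ≤ (n + 1) ^ Fintype.card ι := by
  classical
  have h : (Finset.univ.image (letterCount : (Fin n → ι) → ι → ℕ)).card ≤
      (Finset.univ : Finset (ι → Fin (n + 1))).card := by
    refine Finset.card_le_card_of_injOn
      (fun k i => (⟨min (k i) n, Nat.lt_succ_of_le (min_le_right _ _)⟩ : Fin (n + 1)))
      (fun _ _ => Finset.mem_coe.2 (Finset.mem_univ _)) ?_
    rintro k hk k' hk' hkk'
    obtain ⟨u, -, rfl⟩ := Finset.mem_image.1 (Finset.mem_coe.1 hk)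
    obtain ⟨u', -, rfl⟩ := Finset.mem_image.1 (Finset.mem_coe.1 hk')
    funext i
    have h1 := congrFun hkk' i
    simp only [Fin.mk.injEq] at h1
    rwa [min_eq_left (letterCount_le u i), min_eq_left (letterCount_le u' i)] at h1
  simpa [Fintype.card_fin] using h

/-- **Counting words by types**: if every type class `{u | letterCount u = k}` with `p k` has at most `B`
elements, then at most `(n+1)^|ι| · B` words have a type satisfying `p`. [folklore] -/
theorem card_filter_letterCount_le [Fintype ι] (p : (ι → ℕ) → Prop) [DecidablePred p] {B : ℝ}
    (hB0 : 0 ≤ B)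
    (hB : ∀ k, p k → ((Finset.univ.filter fun u : Fin n → ι => letterCount u = k).card : ℝ) ≤ B) :
    ((Finset.univ.filter fun u : Fin n → ι => p (letterCount u)).card : ℝ) ≤
      (n + 1) ^ Fintype.card ι * B := by
  classical
  set S := Finset.univ.filter fun u : Fin n → ι => p (letterCount u) with hS
  set T := (Finset.univ.image (letterCount : (Fin n → ι) → ι → ℕ)).filter p with hT
  have hmaps : (S : Set (Fin n → ι)).MapsTo letterCount T := by
    intro u hu
    have hu' := (Finset.mem_filter.1 (Finset.mem_coe.1 hu)).2
    exact Finset.mem_coe.2 (Finset.mem_filter.2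
      ⟨Finset.mem_image.2 ⟨u, Finset.mem_univ _, rfl⟩, hu'⟩)
  have hcard := Finset.card_eq_sum_card_fiberwise hmaps
  have hTcard : (T.card : ℝ) ≤ (n + 1) ^ Fintype.card ι := by
    have h1 : T.card ≤ (n + 1) ^ Fintype.card ι :=
      (Finset.card_filter_le _ _).trans card_image_letterCount_le
    exact_mod_cast h1
  calc (S.card : ℝ) = ∑ k ∈ T, ((S.filter fun u => letterCount u = k).card : ℝ) := by
        rw [hcard]; push_cast; rfl
    _ ≤ ∑ k ∈ T, B := by
        refine Finset.sum_le_sum fun k hk => ?_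
        have hpk : p k := (Finset.mem_filter.1 hk).2
        refine le_trans ?_ (hB k hpk)
        exact_mod_cast Finset.card_le_card
          (Finset.monotone_filter_left _ (Finset.filter_subset _ _))
    _ = T.card * B := by rw [Finset.sum_const, nsmul_eq_mul]
    _ ≤ (n + 1) ^ Fintype.card ι * B := mul_le_mul_of_nonneg_right hTcard hB0

end WordType

/-! ## The weight `∏ᵢ (kᵢ/n)^{kᵢ} = 2^{-n H(k/n)}` of a type and the size of a type class -/

section TypeWeight

variable {ι : Type*} [Fintype ι] {n : ℕ}

/-- The **type weight** `typeWeight n k = ∏ᵢ (kᵢ/n)^{kᵢ}`: the probability of a fixed word of type `k`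
under `n` i.i.d. draws from the empirical distribution `k/n`; equals `2^{-n H(k/n)}`
(`typeWeight_eq_exp`). [folklore] -/
def typeWeight (n : ℕ) (k : ι → ℕ) : ℝ := ∏ i, ((k i : ℝ) / n) ^ k i

/-- Unfolding of `typeWeight`. [folklore] -/
theorem typeWeight_def (n : ℕ) (k : ι → ℕ) : typeWeight n k = ∏ i, ((k i : ℝ) / n) ^ k i := rfl

/-- `typeWeight n k ≥ 0`. [folklore] -/
theorem typeWeight_nonneg (n : ℕ) (k : ι → ℕ) : 0 ≤ typeWeight n k :=
  Finset.prod_nonneg fun _ _ => pow_nonneg (div_nonneg (Nat.cast_nonneg _) (Nat.cast_nonneg _)) _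

omit [Fintype ι] in
/-- Each factor `(kᵢ/n)^{kᵢ}` is positive for `n > 0` (it is `1` when `kᵢ = 0`). [folklore] -/
theorem typeWeight_factor_pos (hn : 0 < n) (k : ι → ℕ) (i : ι) : 0 < ((k i : ℝ) / n) ^ k i := by
  rcases Nat.eq_zero_or_pos (k i) with h | h
  · rw [h, pow_zero]; exact one_pos
  · exact pow_pos (div_pos (by exact_mod_cast h) (by exact_mod_cast hn)) _

/-- `typeWeight n k > 0` for `n > 0`. [folklore] -/
theorem typeWeight_pos (hn : 0 < n) (k : ι → ℕ) : 0 < typeWeight n k :=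
  Finset.prod_pos fun i _ => typeWeight_factor_pos hn k i

/-- `log typeWeight n k = ∑ᵢ kᵢ log (kᵢ/n)`. [folklore] -/
theorem log_typeWeight (hn : 0 < n) (k : ι → ℕ) :
    Real.log (typeWeight n k) = ∑ i, (k i : ℝ) * Real.log ((k i : ℝ) / n) := by
  rw [typeWeight_def, Real.log_prod fun i _ => (typeWeight_factor_pos hn k i).ne']
  exact Finset.sum_congr rfl fun i _ => Real.log_pow _ _

/-- The entropy sum of an empirical distribution: `∑ᵢ -(kᵢ/n) log (kᵢ/n) = -(log typeWeight n k)/n`.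
[folklore] -/
theorem sum_negMulLog_type (hn : 0 < n) (k : ι → ℕ) :
    ∑ i, negMulLog ((k i : ℝ) / n) = -Real.log (typeWeight n k) / n := by
  rw [log_typeWeight hn, ← Finset.sum_neg_distrib, Finset.sum_div]
  refine Finset.sum_congr rfl fun i _ => ?_
  rw [Real.negMulLog]
  ring

/-- **`H(k/n) = -log₂(typeWeight n k)/n`**: the Shannon entropy (bits) of the empirical distribution
of a type. [folklore] -/
theorem shannonEntropy_type (hn : 0 < n) (k : ι → ℕ) :
    shannonEntropy (fun i => (k i : ℝ) / n) = -Real.log (typeWeight n k) / (n * Real.log 2) := by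
  rw [shannonEntropy_def, sum_negMulLog_type hn, div_div]

/-- **`typeWeight n k = 2^{-n H(k/n)}`**, written with `exp`: `= exp (-(n log 2) H(k/n))`. [folklore] -/
theorem typeWeight_eq_exp (hn : 0 < n) (k : ι → ℕ) :
    typeWeight n k = Real.exp (-(n * Real.log 2) * shannonEntropy (fun i => (k i : ℝ) / n)) := by
  rw [shannonEntropy_type hn]
  have h2 : (n : ℝ) * Real.log 2 ≠ 0 :=
    mul_ne_zero (by exact_mod_cast hn.ne') (Real.log_pos one_lt_two).ne'
  rw [show -(↑n * Real.log 2) * (-Real.log (typeWeight n k) / (↑n * Real.log 2)) =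
      Real.log (typeWeight n k) by field_simp]
  rw [Real.exp_log (typeWeight_pos hn k)]

variable [DecidableEq ι]

/-- **Size of a type class** (multinomial theorem): `#{u | letterCount u = k} · typeWeight n k ≤ 1`, i.e.
there are at most `2^{n H(k/n)}` words of type `k`. [folklore] -/
theorem card_letterCount_class_mul_typeWeight_le (hn : 0 < n) (k : ι → ℕ) (hk : ∑ i, k i = n) :
    ((Finset.univ.filter fun u : Fin n → ι => letterCount u = k).card : ℝ) * typeWeight n k ≤ 1 := by
  set p : ι → ℝ := fun i => (k i : ℝ) / n with hp
  have hn' : (n : ℝ) ≠ 0 := by exact_mod_cast hn.ne'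
  have hp1 : ∑ i, p i = 1 := by
    simp only [hp, ← Finset.sum_div]
    rw [div_eq_one_iff_eq hn']
    exact_mod_cast hk
  have hp0 : ∀ i, 0 ≤ p i := fun i => div_nonneg (Nat.cast_nonneg _) (Nat.cast_nonneg _)
  have hsum : ∑ u : Fin n → ι, ∏ m, p (u m) = 1 := by rw [← Fintype.sum_pow, hp1, one_pow]
  have hle : ∑ u ∈ Finset.univ.filter (fun u : Fin n → ι => letterCount u = k), ∏ m, p (u m) ≤
      ∑ u : Fin n → ι, ∏ m, p (u m) :=
    Finset.sum_le_sum_of_subset_of_nonneg (Finset.filter_subset _ _)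
      fun u _ _ => Finset.prod_nonneg fun m _ => hp0 _
  have heq : ∑ u ∈ Finset.univ.filter (fun u : Fin n → ι => letterCount u = k), ∏ m, p (u m) =
      ((Finset.univ.filter fun u : Fin n → ι => letterCount u = k).card : ℝ) * typeWeight n k := by
    have hterm : ∀ u ∈ Finset.univ.filter (fun u : Fin n → ι => letterCount u = k),
        ∏ m, p (u m) = typeWeight n k := by
      intro u hu
      rw [prod_apply_eq_prod_pow_letterCount p u, (Finset.mem_filter.1 hu).2]
      rfl
    rw [Finset.sum_congr rfl hterm, Finset.sum_const, nsmul_eq_mul]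
  rw [← heq]
  exact hle.trans_eq hsum

omit [DecidableEq ι] in
/-- **Gibbs' inequality in product form**: for a nonnegative sub-probability vector `r` and a type `k`
of words of length `n`, `∏ᵢ rᵢ^{kᵢ} ≤ ∏ᵢ (kᵢ/n)^{kᵢ}` — the probability of a word under `r^{⊗n}` is at
most `2^{-n H}` of its empirical entropy `H`. [folklore] -/
theorem prod_pow_letterCount_le_typeWeight (hn : 0 < n) {r : ι → ℝ} (hr0 : ∀ i, 0 ≤ r i)
    (hr1 : ∑ i, r i ≤ 1) (k : ι → ℕ) (hk : ∑ i, k i = n) : ∏ i, r i ^ k i ≤ typeWeight n k := by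
  by_cases hz : ∃ i, k i ≠ 0 ∧ r i = 0
  · obtain ⟨i, hki, hri⟩ := hz
    rw [Finset.prod_eq_zero (Finset.mem_univ i) (by rw [hri, zero_pow hki])]
    exact typeWeight_nonneg _ _
  push Not at hz
  have hn' : (n : ℝ) ≠ 0 := by exact_mod_cast hn.ne'
  have hnpos : (0 : ℝ) < n := by exact_mod_cast hn
  set p : ι → ℝ := fun i => (k i : ℝ) / n with hp
  have hp1 : ∑ i, p i = 1 := by
    simp only [hp, ← Finset.sum_div]
    rw [div_eq_one_iff_eq hn']
    exact_mod_cast hk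
  have hp0 : ∀ i, 0 ≤ p i := fun i => div_nonneg (Nat.cast_nonneg _) (Nat.cast_nonneg _)
  have hpr : ∀ i, p i ≠ 0 → 0 < r i := by
    intro i hi
    have hki : k i ≠ 0 := by
      intro h0
      apply hi
      simp [hp, h0]
    exact (hr0 i).lt_of_ne' (hz i hki)
  -- Gibbs: `∑ -(k/n) log (k/n) ≤ ∑ (k/n) (-log r)`
  have hG := sum_negMulLog_le_sum_mul_neg_log hp0 hp1 hr0 hr1 hpr
  have hG' : ∑ i, negMulLog ((k i : ℝ) / n) ≤ ∑ i, (k i : ℝ) / n * -Real.log (r i) := hG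
  rw [sum_negMulLog_type hn] at hG'
  -- the right-hand side is `-(∑ k log r)/n`
  have hR : ∑ i, (k i : ℝ) / n * -Real.log (r i) = -(∑ i, (k i : ℝ) * Real.log (r i)) / n := by
    rw [← Finset.sum_neg_distrib, Finset.sum_div]
    exact Finset.sum_congr rfl fun i _ => by ring
  rw [hR, div_le_div_iff_of_pos_right hnpos, neg_le_neg_iff] at hG'
  -- `∑ k log r = log ∏ r^k`, all factors being nonzero
  have hfac : ∀ i, r i ^ k i ≠ 0 := by
    intro i
    rcases Nat.eq_zero_or_pos (k i) with h | h
    · rw [h, pow_zero]; exact one_ne_zero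
    · exact pow_ne_zero _ (hz i h.ne')
  have hprodpos : 0 < ∏ i, r i ^ k i :=
    Finset.prod_pos fun i _ => (pow_nonneg (hr0 i) _).lt_of_ne' (hfac i)
  have hlog : Real.log (∏ i, r i ^ k i) = ∑ i, (k i : ℝ) * Real.log (r i) := by
    rw [Real.log_prod fun i _ => hfac i]
    exact Finset.sum_congr rfl fun i _ => Real.log_pow _ _
  rw [← hlog] at hG'
  exact (Real.log_le_log_iff hprodpos (typeWeight_pos hn k)).1 hG'

/-- The probability `∏ₘ r(uₘ)` of a word `u` under the product law `r^{⊗n}` is at most the weight of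
its type, `2^{-n H(type/n)}`. [folklore] -/
theorem prod_apply_le_typeWeight_letterCount (hn : 0 < n) {r : ι → ℝ} (hr0 : ∀ i, 0 ≤ r i)
    (hr1 : ∑ i, r i ≤ 1) (u : Fin n → ι) : ∏ m, r (u m) ≤ typeWeight n (letterCount u) := by
  rw [prod_apply_eq_prod_pow_letterCount r u]
  exact prod_pow_letterCount_le_typeWeight hn hr0 hr1 _ (sum_letterCount u)

/-- The same bound in entropy form: `∏ₘ r(uₘ) ≤ exp (-(n log 2) H(letterCount u / n))`. [folklore] -/
theorem prod_apply_le_exp_entropy (hn : 0 < n) {r : ι → ℝ} (hr0 : ∀ i, 0 ≤ r i)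
    (hr1 : ∑ i, r i ≤ 1) (u : Fin n → ι) :
    ∏ m, r (u m) ≤
      Real.exp (-(n * Real.log 2) * shannonEntropy (fun i => (letterCount u i : ℝ) / n)) := by
  rw [← typeWeight_eq_exp hn]
  exact prod_apply_le_typeWeight_letterCount hn hr0 hr1 u

/-- **Few words of low empirical entropy**: at most `(n+1)^|ι| · exp ((n log 2) h)` words `u` of
length `n ≥ 1` have `H(letterCount u / n) ≤ h`. [folklore] -/
theorem card_filter_entropy_le (hn : 0 < n) (h : ℝ) :
    ((Finset.univ.filter fun u : Fin n → ι =>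
        shannonEntropy (fun i => (letterCount u i : ℝ) / n) ≤ h).card : ℝ) ≤
      (n + 1) ^ Fintype.card ι * Real.exp (n * Real.log 2 * h) := by
  classical
  refine card_filter_letterCount_le (fun k : ι → ℕ => shannonEntropy (fun i => (k i : ℝ) / n) ≤ h)
    (Real.exp_pos _).le fun k hk => ?_
  -- a type class is either empty or has `∑ k = n`, and then `card ≤ 1/typeWeight ≤ exp(n log2 · h)`
  by_cases hne : (Finset.univ.filter fun u : Fin n → ι => letterCount u = k).Nonempty
  · obtain ⟨u, hu⟩ := hne
    have hku : letterCount u = k := (Finset.mem_filter.1 hu).2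
    have hksum : ∑ i, k i = n := by rw [← hku]; exact sum_letterCount u
    have hcw := card_letterCount_class_mul_typeWeight_le hn k hksum
    have hwpos := typeWeight_pos hn k
    rw [← le_div_iff₀ hwpos] at hcw
    refine hcw.trans ?_
    rw [typeWeight_eq_exp hn, one_div, ← Real.exp_neg, Real.exp_le_exp]
    have h2 : 0 ≤ (n : ℝ) * Real.log 2 := mul_nonneg (Nat.cast_nonneg _) (Real.log_nonneg one_le_two)
    nlinarith [mul_le_mul_of_nonneg_left hk h2]
  · rw [Finset.not_nonempty_iff_eq_empty.1 hne, Finset.card_empty, Nat.cast_zero]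
    exact (Real.exp_pos _).le

end TypeWeight

/-! ## Concentration of the type under a product law (Chebyshev) -/

section Concentration

variable {ι : Type*} [Fintype ι] {n : ℕ}

/-- The expectation under `r^{⊗n}` of a product of per-position functions factorises:
`∑ᵤ ∏ₘ r(uₘ) gₘ(uₘ) = ∏ₘ ∑ᵢ rᵢ gₘ(i)`. [folklore] -/
theorem sum_prod_mul_eq_prod_sum (r : ι → ℝ) (g : Fin n → ι → ℝ) :
    ∑ u : Fin n → ι, ∏ m, r (u m) * g m (u m) = ∏ m, ∑ i, r i * g m i :=
  (Fintype.prod_sum fun (m : Fin n) (i : ι) => r i * g m i).symm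

variable [DecidableEq ι]

/-- Cross terms vanish: for positions `m ≠ m'` the centred indicators `[uₘ = i] - rᵢ` and
`[u_{m'} = i] - rᵢ` are uncorrelated under `r^{⊗n}` (`∑ r = 1`). [folklore] -/
theorem sum_prod_mul_centred_mul_centred_eq_zero {r : ι → ℝ} (hr1 : ∑ i, r i = 1) (i : ι)
    {m m' : Fin n} (hmm' : m ≠ m') :
    ∑ u : Fin n → ι, (∏ m'', r (u m'')) *
      (((if u m = i then (1 : ℝ) else 0) - r i) * ((if u m' = i then (1 : ℝ) else 0) - r i)) = 0 := by
  set a : ι → ℝ := fun j => (if j = i then (1 : ℝ) else 0) - r i with ha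
  set g : Fin n → ι → ℝ := fun m'' j => if m'' = m then a j else if m'' = m' then a j else 1 with hg
  have hprod : ∀ u : Fin n → ι, ∏ m'', g m'' (u m'') = a (u m) * a (u m') := by
    intro u
    rw [Fintype.prod_eq_mul m m' hmm']
    · simp [hg, hmm'.symm]
    · intro x hx
      simp [hg, hx.1, hx.2]
  have hlhs : ∑ u : Fin n → ι, (∏ m'', r (u m'')) * (a (u m) * a (u m')) =
      ∑ u : Fin n → ι, ∏ m'', r (u m'') * g m'' (u m'') := by
    refine Finset.sum_congr rfl fun u _ => ?_
    rw [Finset.prod_mul_distrib, hprod]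
  have ha0 : ∑ j, r j * a j = 0 := by
    simp only [ha, mul_sub, Finset.sum_sub_distrib, mul_ite, mul_one, mul_zero, Finset.sum_ite_eq',
      Finset.mem_univ, if_true, ← Finset.sum_mul, hr1, one_mul, sub_self]
  change ∑ u : Fin n → ι, (∏ m'', r (u m'')) * (a (u m) * a (u m')) = 0
  rw [hlhs, sum_prod_mul_eq_prod_sum, Finset.prod_eq_zero (Finset.mem_univ m)]
  simp [hg, ha0]

/-- Diagonal terms are at most `1`: `∑ᵤ r^{⊗n}(u) ([uₘ = i] - rᵢ)² ≤ 1` (`0 ≤ r`, `∑ r = 1`).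
[folklore] -/
theorem sum_prod_mul_centred_sq_le_one {r : ι → ℝ} (hr0 : ∀ i, 0 ≤ r i) (hr1 : ∑ i, r i = 1)
    (i : ι) (m : Fin n) :
    ∑ u : Fin n → ι, (∏ m'', r (u m'')) * ((if u m = i then (1 : ℝ) else 0) - r i) ^ 2 ≤ 1 := by
  have hri1 : r i ≤ 1 := by
    rw [← hr1]; exact Finset.single_le_sum (fun j _ => hr0 j) (Finset.mem_univ i)
  have hsq : ∀ u : Fin n → ι, ((if u m = i then (1 : ℝ) else 0) - r i) ^ 2 ≤ 1 := by
    intro u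
    split_ifs
    · nlinarith [hr0 i]
    · nlinarith [hr0 i]
  calc ∑ u : Fin n → ι, (∏ m'', r (u m'')) * ((if u m = i then (1 : ℝ) else 0) - r i) ^ 2
      ≤ ∑ u : Fin n → ι, (∏ m'', r (u m'')) * 1 :=
        Finset.sum_le_sum fun u _ => mul_le_mul_of_nonneg_left (hsq u)
          (Finset.prod_nonneg fun _ _ => hr0 _)
    _ = 1 := by rw [← Finset.sum_mul, ← Fintype.sum_pow, hr1, one_pow, one_mul]

/-- **Variance bound for a letter count**: `∑ᵤ r^{⊗n}(u) (Nᵢ(u) - n rᵢ)² ≤ n`, where `Nᵢ(u)` is the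
number of occurrences of `i` in `u` (the exact value is `n rᵢ(1 - rᵢ)`). [folklore] -/
theorem sum_prod_mul_sq_letterCount_sub_le {r : ι → ℝ} (hr0 : ∀ i, 0 ≤ r i) (hr1 : ∑ i, r i = 1)
    (i : ι) :
    ∑ u : Fin n → ι, (∏ m, r (u m)) * ((letterCount u i : ℝ) - n * r i) ^ 2 ≤ n := by
  set a : (Fin n → ι) → Fin n → ℝ := fun u m => (if u m = i then (1 : ℝ) else 0) - r i with ha
  have hdev : ∀ u : Fin n → ι, (letterCount u i : ℝ) - n * r i = ∑ m, a u m := by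
    intro u
    rw [letterCount_eq_sum_ite, ha]
    simp only [Finset.sum_sub_distrib, Finset.sum_const, Finset.card_univ, Fintype.card_fin,
      nsmul_eq_mul]
  have hexp : ∀ u : Fin n → ι, ((letterCount u i : ℝ) - n * r i) ^ 2 = ∑ m, ∑ m', a u m * a u m' := by
    intro u
    rw [hdev u, sq, Finset.sum_mul_sum]
  simp_rw [hexp, Finset.mul_sum]
  rw [Finset.sum_comm]
  have hinner : ∀ m : Fin n,
      ∑ u : Fin n → ι, ∑ m', (∏ m'', r (u m'')) * (a u m * a u m') ≤ 1 := by
    intro m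
    rw [Finset.sum_comm, Finset.sum_eq_single m]
    · have h := sum_prod_mul_centred_sq_le_one (n := n) hr0 hr1 i m
      simpa only [ha, sq] using h
    · intro m' _ hm'
      exact sum_prod_mul_centred_mul_centred_eq_zero hr1 i (Ne.symm hm')
    · intro h; exact absurd (Finset.mem_univ m) h
  calc ∑ m : Fin n, ∑ u : Fin n → ι, ∑ m', (∏ m'', r (u m'')) * (a u m * a u m')
      ≤ ∑ _m : Fin n, (1 : ℝ) := Finset.sum_le_sum fun m _ => hinner m
    _ = n := by simp

/-- **Chebyshev for the empirical frequency of a letter**: under `r^{⊗n}` (`n ≥ 1`) the words whose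
frequency of `i` deviates from `rᵢ` by at least `η > 0` have total mass at most `1/(n η²)`.
[folklore] -/
theorem sum_prod_filter_freq_far_le {r : ι → ℝ} (hr0 : ∀ i, 0 ≤ r i) (hr1 : ∑ i, r i = 1)
    (i : ι) {η : ℝ} (hη : 0 < η) (hn : 0 < n) :
    ∑ u ∈ Finset.univ.filter (fun u : Fin n → ι => η ≤ |(letterCount u i : ℝ) / n - r i|),
      ∏ m, r (u m) ≤ 1 / (n * η ^ 2) := by
  have hnpos : (0 : ℝ) < n := by exact_mod_cast hn
  have hnη : 0 < (n : ℝ) * η := mul_pos hnpos hη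
  set w : (Fin n → ι) → ℝ := fun u => ∏ m, r (u m) with hw
  have hw0 : ∀ u, 0 ≤ w u := fun u => Finset.prod_nonneg fun _ _ => hr0 _
  -- on the deviation set, `1 ≤ (Nᵢ - n rᵢ)² / (n η)²`
  have hdom : ∀ u ∈ Finset.univ.filter (fun u : Fin n → ι => η ≤ |(letterCount u i : ℝ) / n - r i|),
      w u ≤ w u * ((letterCount u i : ℝ) - n * r i) ^ 2 / ((n : ℝ) * η) ^ 2 := by
    intro u hu
    have hu' : η ≤ |(letterCount u i : ℝ) / n - r i| := (Finset.mem_filter.1 hu).2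
    have h1 : (n : ℝ) * η ≤ |(letterCount u i : ℝ) - n * r i| := by
      have : (letterCount u i : ℝ) - n * r i = n * ((letterCount u i : ℝ) / n - r i) := by
        field_simp
      rw [this, abs_mul, abs_of_pos hnpos]
      exact mul_le_mul_of_nonneg_left hu' hnpos.le
    have h2 : ((n : ℝ) * η) ^ 2 ≤ ((letterCount u i : ℝ) - n * r i) ^ 2 := by
      rw [← sq_abs ((letterCount u i : ℝ) - n * r i)]
      exact pow_le_pow_left₀ hnη.le h1 2
    rw [mul_div_assoc]
    refine le_mul_of_one_le_right (hw0 u) ?_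
    rwa [one_le_div (pow_pos hnη 2)]
  calc ∑ u ∈ Finset.univ.filter (fun u : Fin n → ι => η ≤ |(letterCount u i : ℝ) / n - r i|), w u
      ≤ ∑ u ∈ Finset.univ.filter (fun u : Fin n → ι => η ≤ |(letterCount u i : ℝ) / n - r i|),
          w u * ((letterCount u i : ℝ) - n * r i) ^ 2 / ((n : ℝ) * η) ^ 2 :=
        Finset.sum_le_sum hdom
    _ ≤ ∑ u : Fin n → ι, w u * ((letterCount u i : ℝ) - n * r i) ^ 2 / ((n : ℝ) * η) ^ 2 :=
        Finset.sum_le_sum_of_subset_of_nonneg (Finset.filter_subset _ _) fun u _ _ =>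
          div_nonneg (mul_nonneg (hw0 u) (sq_nonneg _)) (sq_nonneg _)
    _ = (∑ u : Fin n → ι, w u * ((letterCount u i : ℝ) - n * r i) ^ 2) / ((n : ℝ) * η) ^ 2 := by
        rw [Finset.sum_div]
    _ ≤ n / ((n : ℝ) * η) ^ 2 :=
        div_le_div_of_nonneg_right (sum_prod_mul_sq_letterCount_sub_le hr0 hr1 i) (sq_nonneg _)
    _ = 1 / (n * η ^ 2) := by
        field_simp

omit [DecidableEq ι] in
/-- `shannonEntropy` is continuous (a finite sum of the continuous `-x log x`). [folklore] -/
theorem continuous_shannonEntropy : Continuous (shannonEntropy : (ι → ℝ) → ℝ) := by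
  unfold shannonEntropy
  exact (continuous_finsetSum _ fun i _ =>
    Real.continuous_negMulLog.comp (continuous_apply i)).div_const _

/-- **Words of atypically low empirical entropy are rare**: for a probability vector `r` and `δ > 0`
there is `C` such that for every `n ≥ 1` the `r^{⊗n}`-mass of the words `u` with
`H(letterCount u / n) ≤ H(r) - δ` is at most `C / n` (continuity of `H` at `r` and Chebyshev).
[folklore] -/
theorem exists_sum_prod_filter_entropy_le {r : ι → ℝ} (hr0 : ∀ i, 0 ≤ r i) (hr1 : ∑ i, r i = 1)
    {δ : ℝ} (hδ : 0 < δ) :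
    ∃ C : ℝ, 0 ≤ C ∧ ∀ n : ℕ, 0 < n →
      ∑ u ∈ Finset.univ.filter (fun u : Fin n → ι =>
          shannonEntropy (fun i => (letterCount u i : ℝ) / n) ≤ shannonEntropy r - δ),
        ∏ m, r (u m) ≤ C / n := by
  classical
  -- continuity of `H` at `r` in the sup metric
  obtain ⟨η, hη, hcont⟩ := Metric.continuous_iff.1 continuous_shannonEntropy r δ hδ
  refine ⟨Fintype.card ι / η ^ 2, div_nonneg (Nat.cast_nonneg _) (sq_nonneg _), fun n hn => ?_⟩
  set F := Finset.univ.filter (fun u : Fin n → ι =>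
      shannonEntropy (fun i => (letterCount u i : ℝ) / n) ≤ shannonEntropy r - δ) with hF
  set G : ι → Finset (Fin n → ι) := fun i =>
      Finset.univ.filter (fun u : Fin n → ι => η ≤ |(letterCount u i : ℝ) / n - r i|) with hG
  set w : (Fin n → ι) → ℝ := fun u => ∏ m, r (u m) with hw
  have hw0 : ∀ u, 0 ≤ w u := fun u => Finset.prod_nonneg fun _ _ => hr0 _
  -- every word in `F` deviates in some letter
  have hcover : ∀ u ∈ F, ∃ i, u ∈ G i := by
    intro u hu
    have hu' := (Finset.mem_filter.1 hu).2
    by_contra hno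
    push Not at hno
    have hdist : dist (fun i => (letterCount u i : ℝ) / n) r < η := by
      refine (dist_pi_lt_iff hη).2 fun i => ?_
      have := hno i
      rw [hG] at this
      simp only [Finset.mem_filter, Finset.mem_univ, true_and, not_le] at this
      rwa [Real.dist_eq]
    have h := hcont _ hdist
    rw [Real.dist_eq, abs_lt] at h
    linarith [h.1]
  -- indicator domination `1_F ≤ ∑ᵢ 1_{Gᵢ}`
  have hind : ∀ u, (if u ∈ F then w u else 0) ≤ ∑ i, if u ∈ G i then w u else 0 := by
    intro u
    split_ifs with hu
    · obtain ⟨i, hi⟩ := hcover u hu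
      have hnn : ∀ j ∈ (Finset.univ : Finset ι), 0 ≤ (if u ∈ G j then w u else 0) := by
        intro j _
        split_ifs <;> simp [hw0 u]
      calc w u = if u ∈ G i then w u else 0 := by rw [if_pos hi]
        _ ≤ ∑ i, if u ∈ G i then w u else 0 :=
          Finset.single_le_sum (f := fun j => if u ∈ G j then w u else 0) hnn (Finset.mem_univ i)
    · exact Finset.sum_nonneg fun j _ => by split_ifs <;> simp [hw0 u]
  calc ∑ u ∈ F, w u = ∑ u, if u ∈ F then w u else 0 := by
        rw [← Finset.sum_filter]; congr 1; ext u; simp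
    _ ≤ ∑ u, ∑ i, if u ∈ G i then w u else 0 := Finset.sum_le_sum fun u _ => hind u
    _ = ∑ i, ∑ u ∈ G i, w u := by
        rw [Finset.sum_comm]
        refine Finset.sum_congr rfl fun i _ => ?_
        rw [← Finset.sum_filter]; congr 1; ext u; simp
    _ ≤ ∑ _i : ι, 1 / (n * η ^ 2) :=
        Finset.sum_le_sum fun i _ => sum_prod_filter_freq_far_le hr0 hr1 i hη hn
    _ = Fintype.card ι / η ^ 2 / n := by
        rw [Finset.sum_const, Finset.card_univ, nsmul_eq_mul]
        field_simp

end Concentration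

end Literature.Computability.AlgebraicComplexity
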